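import Mathlib.Analysis.Calculus.FDeriv.Symmetric
import Literature.Analysis.Calculus.LiouvilleDeterminant
import Literature.Analysis.FluidPDE.InverseFlowTransport
import HarnessLib

/-!
# Area-preserving explicit isotopies have divergence-free Eulerian velocity
(Alberti–Crippa–Mazzucato 2019, §7, opening remark — the divergence half)

Topic `Literature/Analysis/FluidPDE`. Alberti–Crippa–Mazzucato, JAMS 32 (2019), §7 open the
construction of their building blocks with the remark (arXiv:1605.02090, p. 22): if
`{Φ(t,·)}` is an area-preserving flow of class `C^k`, `k ≥ 2` ("which, for regular flows, is
equivalent to imposing `JΦ(t,z) := det(∇Φ(t,z)) = 1`"), then "it is then well-known that the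
velocity field `w(t,x) := ∂ₜΦ(t,z)` with `x = Φ(t,z)` is of class `C^{k-1}` and divergence-free",
and `ρ̄ ∘ Φ(t,·)⁻¹` solves the transport equation. The transport half is the accepted
`InverseFlowTransport.lean` (`InverseFlow.IsInversePair.transport`, for a pair `X_t`, `Y_t = X_t⁻¹`
of explicit mutually inverse maps and the Eulerian velocity `InverseFlow.eulerVelocity X Y`);
this file proves the **divergence half** in the plane, in the pointwise shape consumed by
`Literature.Analysis.FluidPDE.QuasiSelfSimilar.IsCompatibleBlockSystem.divFree`
(`Σⱼ (D V_t(x) eⱼ)ⱼ = 0`):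

* `InverseFlow.hasDerivAt_fderiv_slice` — for `X` jointly `C^∞`, the Jacobian along a trajectory,
  `s ↦ D(X_s)(z)`, has time derivative `D(Ẋ_t)(z)` (symmetry of second derivatives);
* `InverseFlow.IsInversePair.hasDerivAt_fderiv` — `∂ₜ D(X_t)(z) = D(V_t)(X_t z) ∘ D(X_t)(z)`,
  the linearised flow equation, with `V = eulerVelocity X Y`;
* `Literature.Analysis.Calculus.hasDerivAt_det_of_hasDerivAt_clm_comp_fin_two` — Jacobi's formula
  `(det A)' = tr B · det A` for operator curves `A' = B ∘ A` on `ℝ²` (the `ℝ³` version is the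
  accepted `LiouvilleDeterminant.lean`; the `2 × 2` trace identity is again checked by `ring`);
* `InverseFlow.IsInversePair.trace_fderiv_eulerVelocity_eq_zero` and
  `InverseFlow.IsInversePair.sum_fderiv_eulerVelocity_apply_eq_zero` — **the remark**: if
  `det D(X_t)(z) = 1` for all `t, z` then `tr D(V_t)(x) = 0`, i.e. `Σⱼ ∂ⱼ Vⱼ = 0`, at every
  `(t, x)` (Liouville: `0 = ∂ₜ det D(X_t) = (div V)(X_t z) · det D(X_t)`, and `X_t` is onto);
* `InverseFlow.IsInversePair.det_fderiv_eq_one_of_inverse` — the hypothesis may be checked on the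
  inverse maps instead (`det D(Y_t) ≡ 1 ⇒ det D(X_t) ≡ 1`).

Everything is pointwise and global in time (explicit isotopies — shears, squeezes, twists and
their composites — are defined for all `t ∈ ℝ`); no measure theory.

## References

* G. Alberti, G. Crippa, A. L. Mazzucato, *Exponential self-similar mixing by incompressible
  flows*, J. Amer. Math. Soc. 32 (2019), 445–490, §7, remark before Prop. 21 (arXiv:1605.02090,
  p. 22).
* A. J. Majda, A. L. Bertozzi, *Vorticity and Incompressible Flow* (CUP 2002), §1.3 Prop. 1.2,
  (1.15) (Jacobi/Liouville for the Jacobian of a particle-trajectory map).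
-/

noncomputable section

open Function Set
open scoped ContDiff Matrix

/-! ## Jacobi's formula for operator curves on `ℝ²` -/

namespace Literature.Analysis.Calculus

/-- **The trace identity in `ℝ²`**: for a frame `m = (m₀, m₁)` and a matrix `B`,
`det (B m₀, m₁) + det (m₀, B m₁) = tr B · det m` — the `2 × 2` case of the adjugate identity
behind Jacobi's formula (the `3 × 3` case is `sum_det_of_update_mulVec`). A polynomial identity in
the `8` entries, verified by `ring`. [cite: MajdaBertozziCUP2002, §1.3 proof of Prop. 1.2 (p. 14)] -/
theorem sum_det_of_update_mulVec_fin_two (m : Fin 2 → Fin 2 → ℝ) (B : Matrix (Fin 2) (Fin 2) ℝ) :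
    ∑ j, (Matrix.of (update m j (B *ᵥ m j))).det = B.trace * (Matrix.of m).det := by
  simp only [Fin.sum_univ_two, Matrix.det_fin_two, Matrix.of_apply, Matrix.trace_fin_two,
    update_apply, Fin.isValue, Fin.reduceEq, if_true, if_false, Matrix.mulVec, dotProduct]
  ring

/-- **Jacobi's formula for operators on `ℝ²`**: if `A : ℝ → (ℝ² →L ℝ²)` has derivative
`B ∘ A(t)` at `t`, then `det A` has derivative `tr B · det A(t)` at `t` (Majda–Bertozzi (1.15),
`∂ₜJ = (div v) J`, in operator form; the planar companion of
`hasDerivAt_det_of_hasDerivAt_clm_comp`). [cite: MajdaBertozziCUP2002, §1.3 Prop. 1.2 (1.15) (p. 13–14)] -/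
theorem hasDerivAt_det_of_hasDerivAt_clm_comp_fin_two
    {A : ℝ → (EuclideanSpace ℝ (Fin 2) →L[ℝ] EuclideanSpace ℝ (Fin 2))}
    {B : EuclideanSpace ℝ (Fin 2) →L[ℝ] EuclideanSpace ℝ (Fin 2)} {t : ℝ}
    (hA : HasDerivAt A (B.comp (A t)) t) :
    HasDerivAt (fun u => (A u).det)
      (LinearMap.trace ℝ (EuclideanSpace ℝ (Fin 2))
          (B : EuclideanSpace ℝ (Fin 2) →ₗ[ℝ] EuclideanSpace ℝ (Fin 2)) * (A t).det) t := by
  have hm : HasDerivAt (fun u => frameCLM (Fin 2) (A u)) (frameCLM (Fin 2) (B.comp (A t))) t :=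
    (frameCLM (Fin 2)).hasFDerivAt.comp_hasDerivAt t hA
  have h := hasDerivAt_det_rows hm
  have hsum : ∑ j, (Matrix.of (update (frameCLM (Fin 2) (A t)) j
      (frameCLM (Fin 2) (B.comp (A t)) j))).det =
      LinearMap.trace ℝ (EuclideanSpace ℝ (Fin 2))
        (B : EuclideanSpace ℝ (Fin 2) →ₗ[ℝ] EuclideanSpace ℝ (Fin 2)) * (A t).det := by
    simp_rw [frameCLM_comp_apply]
    rw [sum_det_of_update_mulVec_fin_two, trace_toMatrixOrthonormal_basisFun, det_of_frameCLM]
  rw [hsum] at h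
  simp_rw [det_of_frameCLM] at h
  exact h

/-- **The trace of an operator on `EuclideanSpace ℝ ι` in coordinates**:
`tr L = Σᵢ (L eᵢ)ᵢ`. [folklore] -/
theorem trace_eq_sum_apply_single {ι : Type*} [Fintype ι] [DecidableEq ι]
    (L : EuclideanSpace ℝ ι →L[ℝ] EuclideanSpace ℝ ι) :
    LinearMap.trace ℝ (EuclideanSpace ℝ ι) (L : EuclideanSpace ℝ ι →ₗ[ℝ] EuclideanSpace ℝ ι) =
      ∑ i, L (EuclideanSpace.single i (1 : ℝ)) i := by
  rw [← trace_toMatrixOrthonormal_basisFun, Matrix.trace]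
  simp only [Matrix.diag_apply, toMatrixOrthonormal_basisFun_apply]

end Literature.Analysis.Calculus

/-! ## The divergence of the Eulerian velocity of an area-preserving explicit isotopy -/

namespace Literature.Analysis.FluidPDE

namespace InverseFlow

open Literature.Analysis.Calculus

section General

variable {E : Type*} [NormedAddCommGroup E] [NormedSpace ℝ E]

/-- The space slice of a jointly differentiable map: `D(X_s)(z) = D(X)(s, z) ∘ inr`. [folklore] -/
theorem fderiv_slice_eq_comp_inr {X : ℝ → E → E} {s : ℝ} {z : E}
    (hX : DifferentiableAt ℝ (uncurry X) (s, z)) :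
    fderiv ℝ (X s) z = (fderiv ℝ (uncurry X) (s, z)).comp (ContinuousLinearMap.inr ℝ ℝ E) :=
  (hX.hasFDerivAt.comp z (hasFDerivAt_prodMk_right s z)).fderiv

/-- The trajectory velocity through the space–time derivative: `Ẋ_t z = D(X)(t, z)(1, 0)`. [folklore] -/
theorem deriv_traj_eq_fderiv {X : ℝ → E → E} {t : ℝ} {z : E}
    (hX : DifferentiableAt ℝ (uncurry X) (t, z)) :
    deriv (fun s => X s z) t = fderiv ℝ (uncurry X) (t, z) (1, 0) := by
  have hι : HasDerivAt (fun s : ℝ => (s, z)) (1, 0) t :=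
    (hasDerivAt_id t).prodMk (hasDerivAt_const t z)
  exact (hX.hasFDerivAt.comp_hasDerivAt t hι).deriv

/-- **Time derivative of the Jacobian along a trajectory.** For `X` jointly `C^∞`, the operator
curve `s ↦ D(X_s)(z)` has derivative `D(Ẋ_t)(z)` at `s = t`, where `Ẋ_t z' = ∂ₛ X_s z'|_{s=t}`
(the mixed second derivatives of `(s, z) ↦ X_s z` commute). [folklore] -/
theorem hasDerivAt_fderiv_slice {X : ℝ → E → E} (hX : ContDiff ℝ ∞ (uncurry X)) (t : ℝ) (z : E) :
    HasDerivAt (fun s => fderiv ℝ (X s) z)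
      (fderiv ℝ (fun z' => deriv (fun s => X s z') t) z) t := by
  set Φ : ℝ × E → E := uncurry X with hΦ
  have hΦd : Differentiable ℝ Φ := hX.differentiable (by simp)
  have hDΦ : ContDiff ℝ ∞ (fderiv ℝ Φ) := (contDiff_infty_iff_fderiv.1 hX).2
  have hDΦd : Differentiable ℝ (fderiv ℝ Φ) := hDΦ.differentiable (by simp)
  -- the curve of space slices, as a composite
  have hslice : (fun s => fderiv ℝ (X s) z) =
      fun s => (fderiv ℝ Φ (s, z)).comp (ContinuousLinearMap.inr ℝ ℝ E) := by
    funext s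
    exact fderiv_slice_eq_comp_inr (hΦd (s, z))
  -- its derivative: `D²Φ(t,z)(1,0) ∘ inr`
  have hι : HasDerivAt (fun s : ℝ => (s, z)) (1, 0) t :=
    (hasDerivAt_id t).prodMk (hasDerivAt_const t z)
  have h1 : HasDerivAt (fun s => fderiv ℝ Φ (s, z)) (fderiv ℝ (fderiv ℝ Φ) (t, z) (1, 0)) t :=
    (hDΦd (t, z)).hasFDerivAt.comp_hasDerivAt t hι
  have h2 : HasDerivAt (fun s => (fderiv ℝ Φ (s, z)).comp (ContinuousLinearMap.inr ℝ ℝ E))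
      ((fderiv ℝ (fderiv ℝ Φ) (t, z) (1, 0)).comp (ContinuousLinearMap.inr ℝ ℝ E)) t := by
    have h := h1.clm_comp (hasDerivAt_const t (ContinuousLinearMap.inr ℝ ℝ E))
    simpa using h
  -- the velocity `z' ↦ Ẋ_t z'` as a composite, and its derivative: `w ↦ D²Φ(t,z)(0,w)(1,0)`
  have hvel : (fun z' => deriv (fun s => X s z') t) = fun z' => fderiv ℝ Φ (t, z') (1, 0) := by
    funext z'
    exact deriv_traj_eq_fderiv (hΦd (t, z'))
  have h3 : HasFDerivAt (fun z' => fderiv ℝ Φ (t, z'))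
      ((fderiv ℝ (fderiv ℝ Φ) (t, z)).comp (ContinuousLinearMap.inr ℝ ℝ E)) z :=
    (hDΦd (t, z)).hasFDerivAt.comp z (hasFDerivAt_prodMk_right t z)
  have h4 : HasFDerivAt (fun z' => fderiv ℝ Φ (t, z') ((1 : ℝ), (0 : E)))
      (((fderiv ℝ (fderiv ℝ Φ) (t, z)).comp (ContinuousLinearMap.inr ℝ ℝ E)).flip
        ((1 : ℝ), (0 : E))) z := by
    have h := h3.clm_apply (hasFDerivAt_const ((1 : ℝ), (0 : E)) z)
    simpa using h
  -- symmetry of the second derivative identifies the two operators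
  have hsymm : IsSymmSndFDerivAt ℝ Φ (t, z) :=
    hX.contDiffAt.isSymmSndFDerivAt (by
      rw [minSmoothness_of_isRCLikeNormedField]
      exact (WithTop.coe_le_coe.mpr le_top : ((2 : ℕ∞) : ℕ∞ω) ≤ ((⊤ : ℕ∞) : ℕ∞ω)))
  have heq : ((fderiv ℝ (fderiv ℝ Φ) (t, z)).comp (ContinuousLinearMap.inr ℝ ℝ E)).flip
        ((1 : ℝ), (0 : E)) =
      (fderiv ℝ (fderiv ℝ Φ) (t, z) (1, 0)).comp (ContinuousLinearMap.inr ℝ ℝ E) := by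
    ext w
    simp only [ContinuousLinearMap.flip_apply, ContinuousLinearMap.comp_apply,
      ContinuousLinearMap.inr_apply]
    exact hsymm.eq (0, w) (1, 0)
  rw [hslice, hvel, h4.fderiv, heq]
  exact h2

end General

namespace IsInversePair

variable {E : Type*} [NormedAddCommGroup E] [NormedSpace ℝ E] {X Y : ℝ → E → E}

/-- **The linearised flow equation**: for an inverse pair with `X`, `Y` jointly `C^∞`,
`∂ₜ D(X_t)(z) = D(V_t)(X_t z) ∘ D(X_t)(z)` with `V = eulerVelocity X Y` (differentiate
`Ẋ_t = V_t ∘ X_t` in `z`). [folklore] -/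
theorem hasDerivAt_fderiv (h : IsInversePair X Y) (hX : ContDiff ℝ ∞ (uncurry X))
    (hY : ContDiff ℝ ∞ (uncurry Y)) (t : ℝ) (z : E) :
    HasDerivAt (fun s => fderiv ℝ (X s) z)
      ((fderiv ℝ (eulerVelocity X Y t) (X t z)).comp (fderiv ℝ (X t) z)) t := by
  have hvel : (fun z' => deriv (fun s => X s z') t) = eulerVelocity X Y t ∘ X t := by
    funext z'
    exact (eulerVelocity_apply_self h.left_inv t z').symm
  have hV : Differentiable ℝ (eulerVelocity X Y t) := by
    have hc := (contDiff_eulerVelocity hX hY).differentiable (by simp)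
    exact hc.comp (differentiable_const t |>.prodMk differentiable_id)
  have hXt : Differentiable ℝ (X t) :=
    (hX.differentiable (by simp)).comp (differentiable_const t |>.prodMk differentiable_id)
  have hchain : fderiv ℝ (eulerVelocity X Y t ∘ X t) z =
      (fderiv ℝ (eulerVelocity X Y t) (X t z)).comp (fderiv ℝ (X t) z) :=
    fderiv_comp z (hV (X t z)) (hXt z)
  have hd := hasDerivAt_fderiv_slice hX t z
  rwa [hvel, hchain] at hd

variable {X Y : ℝ → EuclideanSpace ℝ (Fin 2) → EuclideanSpace ℝ (Fin 2)}

/-- **Liouville along a trajectory (planar)**: `∂ₜ det D(X_t)(z) = tr D(V_t)(X_t z) · det D(X_t)(z)`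
(Jacobi's formula with the linearised flow equation; Majda–Bertozzi (1.15) `∂ₜJ = (div v) J`). [cite: MajdaBertozziCUP2002, §1.3 Prop. 1.2 (1.15) (p. 13–14)] -/
theorem hasDerivAt_det_fderiv (h : IsInversePair X Y) (hX : ContDiff ℝ ∞ (uncurry X))
    (hY : ContDiff ℝ ∞ (uncurry Y)) (t : ℝ) (z : (EuclideanSpace ℝ (Fin 2))) :
    HasDerivAt (fun s => (fderiv ℝ (X s) z).det)
      (LinearMap.trace ℝ (EuclideanSpace ℝ (Fin 2)) (fderiv ℝ (eulerVelocity X Y t) (X t z) : (EuclideanSpace ℝ (Fin 2)) →ₗ[ℝ] (EuclideanSpace ℝ (Fin 2))) *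
        (fderiv ℝ (X t) z).det) t :=
  hasDerivAt_det_of_hasDerivAt_clm_comp_fin_two (h.hasDerivAt_fderiv hX hY t z)

/-- **Area-preserving explicit isotopies are divergence-free, trace form** (ACM 2019, §7, remark
before Prop. 21: "`JΦ = 1` … the velocity field `w(t,x) := ∂ₜΦ(t,z)`, `x = Φ(t,z)`, is …
divergence-free"). If `(X, Y)` is an inverse pair of jointly `C^∞` maps of the plane with
`det D(X_t)(z) = 1` for all `t, z`, then `tr D(V_t)(x) = 0` at every `(t, x)`,
`V = eulerVelocity X Y`. [cite: AlbertiCrippaMazzucato2019, §7 (remark before Prop. 21)] -/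
theorem trace_fderiv_eulerVelocity_eq_zero (h : IsInversePair X Y) (hX : ContDiff ℝ ∞ (uncurry X))
    (hY : ContDiff ℝ ∞ (uncurry Y)) (hdet : ∀ t z, (fderiv ℝ (X t) z).det = 1) (t : ℝ) (x : (EuclideanSpace ℝ (Fin 2))) :
    LinearMap.trace ℝ (EuclideanSpace ℝ (Fin 2)) (fderiv ℝ (eulerVelocity X Y t) x : (EuclideanSpace ℝ (Fin 2)) →ₗ[ℝ] (EuclideanSpace ℝ (Fin 2))) = 0 := by
  -- work at the Lagrangian label `z = Y_t x`, `x = X_t z`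
  set z := Y t x with hz
  have hx : X t z = x := h.right_inv t x
  have hJ := h.hasDerivAt_det_fderiv hX hY t z
  have hconst : HasDerivAt (fun s => (fderiv ℝ (X s) z).det) 0 t := by
    have hfun : (fun s => (fderiv ℝ (X s) z).det) = fun _ => (1 : ℝ) := funext fun s => hdet s z
    rw [hfun]
    exact hasDerivAt_const t 1
  have h0 := hJ.unique hconst
  rwa [hdet t z, mul_one, hx] at h0

/-- **Area-preserving explicit isotopies are divergence-free, coordinate form**: under the
hypotheses of `trace_fderiv_eulerVelocity_eq_zero`, `Σⱼ (D V_t(x) eⱼ)ⱼ = 0` — the shape of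
`QuasiSelfSimilar.IsCompatibleBlockSystem.divFree`. [cite: AlbertiCrippaMazzucato2019, §7 (remark before Prop. 21)] -/
theorem sum_fderiv_eulerVelocity_apply_eq_zero (h : IsInversePair X Y)
    (hX : ContDiff ℝ ∞ (uncurry X)) (hY : ContDiff ℝ ∞ (uncurry Y))
    (hdet : ∀ t z, (fderiv ℝ (X t) z).det = 1) (t : ℝ) (x : (EuclideanSpace ℝ (Fin 2))) :
    ∑ j, fderiv ℝ (eulerVelocity X Y t) x (EuclideanSpace.single j 1) j = 0 := by
  rw [← trace_eq_sum_apply_single]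
  exact h.trace_fderiv_eulerVelocity_eq_zero hX hY hdet t x

/-- **Checking the Jacobian on the inverse maps.** For an inverse pair with `X`, `Y` jointly
differentiable, `det D(Y_t)(X_t z) · det D(X_t)(z) = 1`; in particular `det D(Y_t) ≡ 1` implies
`det D(X_t) ≡ 1` (so the hypothesis of `trace_fderiv_eulerVelocity_eq_zero` may be verified on
whichever of the two explicit maps is more convenient). [folklore] -/
theorem det_fderiv_mul_det_fderiv {E : Type*} [NormedAddCommGroup E] [NormedSpace ℝ E]
    [FiniteDimensional ℝ E] {X Y : ℝ → E → E} (h : IsInversePair X Y)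
    (hX : Differentiable ℝ (uncurry X)) (t : ℝ) (z : E) :
    (fderiv ℝ (Y t) (X t z)).det * (fderiv ℝ (X t) z).det = 1 := by
  have hXt : DifferentiableAt ℝ (X t) z :=
    (hX (t, z)).comp z ((differentiableAt_const t).prodMk differentiableAt_id)
  have hYt : DifferentiableAt ℝ (Y t) (X t z) :=
    (h.differentiable_uncurry (t, X t z)).comp (X t z)
      ((differentiableAt_const t).prodMk differentiableAt_id)
  have hcomp : fderiv ℝ (Y t ∘ X t) z = (fderiv ℝ (Y t) (X t z)).comp (fderiv ℝ (X t) z) :=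
    fderiv_comp z hYt hXt
  have hid : fderiv ℝ (Y t ∘ X t) z = ContinuousLinearMap.id ℝ E := by
    have : Y t ∘ X t = id := funext fun w => h.left_inv t w
    rw [this, fderiv_id]
  have hdet := congrArg ContinuousLinearMap.det (hcomp.symm.trans hid)
  simp only [ContinuousLinearMap.det, ContinuousLinearMap.toLinearMap_comp, LinearMap.det_comp,
    ContinuousLinearMap.coe_id, LinearMap.det_id] at hdet
  exact hdet

/-- `det D(Y_t) ≡ 1` implies `det D(X_t) ≡ 1`. [folklore] -/
theorem det_fderiv_eq_one_of_inverse {E : Type*} [NormedAddCommGroup E] [NormedSpace ℝ E]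
    [FiniteDimensional ℝ E] {X Y : ℝ → E → E} (h : IsInversePair X Y)
    (hX : Differentiable ℝ (uncurry X)) (hdetY : ∀ t x, (fderiv ℝ (Y t) x).det = 1)
    (t : ℝ) (z : E) : (fderiv ℝ (X t) z).det = 1 := by
  have hm := h.det_fderiv_mul_det_fderiv hX t z
  rwa [hdetY t (X t z), one_mul] at hm

/-- **The remark with the Jacobian checked on the inverse maps**: `det D(Y_t) ≡ 1` implies
`Σⱼ (D V_t(x) eⱼ)ⱼ = 0`. [cite: AlbertiCrippaMazzucato2019, §7 (remark before Prop. 21)] -/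
theorem sum_fderiv_eulerVelocity_apply_eq_zero_of_inverse (h : IsInversePair X Y)
    (hX : ContDiff ℝ ∞ (uncurry X)) (hY : ContDiff ℝ ∞ (uncurry Y))
    (hdetY : ∀ t x, (fderiv ℝ (Y t) x).det = 1) (t : ℝ) (x : (EuclideanSpace ℝ (Fin 2))) :
    ∑ j, fderiv ℝ (eulerVelocity X Y t) x (EuclideanSpace.single j 1) j = 0 :=
  h.sum_fderiv_eulerVelocity_apply_eq_zero hX hY
    (h.det_fderiv_eq_one_of_inverse (hX.differentiable (by simp)) hdetY) t x

end IsInversePair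

end InverseFlow

end Literature.Analysis.FluidPDE

end
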